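/-
Origin: expansion seat `planner-pub-hodgecm-pohl-g4-0`, handover 2026-08-18 (`HOME/pub-hodgecm-pohl-g4/lean/Pohl4/ToyPohlmannBasis.lean`, md5 d66a1f24, 63 lines);
landed by the gen-6 packager in gate run 22 as `HodgeCM/Model/Toy/PohlmannBasis.lean` (import ^import Pohl3\.→import HodgeCM.Proofs.Pohlmann. ×1; import ^import Pohl4\.ToyCupFacts\b→import HodgeCM.Model.Toy.CupFacts ×1).
-/
/-
Copyright: pub-hodgecm formalisation cell (harness21, 2026). New file (not vendored).
Origin: HOME/pub-hodgecm-pohl-g4/lean/Pohl4/ToyPohlmannBasis.lean — session planner-pub-hodgecm-pohl-g4-0 (unit pub-hodgecm-pohl-g4),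
part (b) `PohlmannSpan`, generation 4.  WIP module `Pohl4.ToyPohlmannBasis`; intended final place
`HodgeCM/Model/Toy/PohlmannBasis.lean` (module `HodgeCM.Model.Toy.PohlmannBasis`; kind L5) — or appended to
`HodgeCM/Model/Toy/CupFacts.lean` (packager's call).  WIP imports to rewrite on landing:
`import Pohl3.WeightLines` ↦ `import HodgeCM.Proofs.Pohlmann.WeightLines` (pohl-g3, run-22 queue, md5 3dd57e5ceb9b; it imports
`PohlmannEq` daebb7b31031 ↦ `HodgeCM.Proofs.Pohlmann.PohlmannEq`), `import Pohl4.ToyCupFacts` ↦ `import HodgeCM.Model.Toy.CupFacts`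
(this seat, handed over 2026-08-18T04:54:13Z, md5 22cb91c789e9).  Lands AFTER those three.
-/
import Summits.HodgeConjecture.HodgeCM.Proofs.Pohlmann.WeightLines
import Summits.HodgeConjecture.HodgeCM.Model.Toy.CupFacts

/-!
# Pohlmann's theorem in print form (Gao–Ullmo Thm 3.1, both sentences) holds in the toy model

With N1–N4 theorems of the exterior CM-model (`HodgeCM.Model.Toy.CupFacts`), the print forms of Pohlmann's theorem
proved from `ModelAxioms` + N1–N4 in `HodgeCM.Proofs.Pohlmann.PohlmannEq` / `…WeightLines` specialise to `toyModel`
under its model axioms alone (i.e. under the single typed input M28 of `toyModel_axioms`):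

* `toyModel_pohlmannBasis (M) : toyModel.PohlmannBasis` — `B^p(A′) ⊗ ℂ = ⨆_{S Hodge weight} V_S`;
* `toyModel_pohlmannTheorem31 (M) : toyModel.PohlmannTheorem31` — basis of `B^p ⊗ ℂ` indexed by the Hodge weights and
  `dim_ℚ B^p(A′) = #{Hodge weights}` (`p ≥ 1`);
* `toyModel_finrank_hodgeClassesOf` — the dimension count alone.

In the toy model `B^p := Hodge classes` (`alg X p := (hs X (2p)).hodgeClasses p`), `H^•(A′) = ⋀^•(⊕_j F)` with the CM-type
filtrations: these are literally the statements Gao–Ullmo recall in JIMJ 25 (2025) §3.1 for `A′ = ∏_j A_{(F,Θ_j)}`, now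
kernel theorems of that model (cross-model consistency with `HodgeCM.GaoUllmo.finrank_Bp_pi_eq_card_hodgeWeight`,
cf-gaoullmo-g2, which computes the same number on Gao–Ullmo's side).
-/

noncomputable section

namespace HodgeCM.Toy

open Literature.AlgebraicGeometry.Motives (CMType)

/-- **`PohlmannBasis` holds in the toy model** (given its model axioms). -/
theorem toyModel_pohlmannBasis (M : toyModel.ModelAxioms) : toyModel.PohlmannBasis :=
  Universe.pohlmannBasis_of_facts M toyModel_fact_cupExterior toyModel_fact_cup_hodge toyModel_fact_pull_H0
    toyModel_fact_hodge_F0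

/-- **Gao–Ullmo Thm 3.1 (basis + dimension form, `p ≥ 1`) holds in the toy model** (given its model axioms). -/
theorem toyModel_pohlmannTheorem31 (M : toyModel.ModelAxioms) : toyModel.PohlmannTheorem31 :=
  Universe.pohlmannTheorem31_of_facts M toyModel_fact_cupExterior toyModel_fact_cup_hodge toyModel_fact_pull_H0
    toyModel_fact_hodge_F0

/-- `dim_ℚ B^p(∏_j A_{(F,Θ_j)}) = #{Hodge weights}` in the toy model, `p ≥ 1`, `F` Galois. -/
theorem toyModel_finrank_hodgeClassesOf (M : toyModel.ModelAxioms) (F : CMField) [IsGalois ℚ F] {n : ℕ}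
    (Θ : Fin (n + 1) → CMType F) {p : ℕ} (hp : 0 < p) :
    Module.finrank ℚ (toyModel.hodgeClassesOf (toyModel.cmProd F Θ) p) =
      Nat.card {S : Fin (n + 1) → Finset ((F : Type) →+* ℂ) // IsHodgeWeight Θ p S} :=
  Universe.finrank_hodgeClassesOf (Θ := Θ) M toyModel_fact_cupExterior toyModel_fact_cup_hodge
    toyModel_fact_pull_H0 toyModel_fact_hodge_F0 hp

/-- The print forms from the single typed input M28. -/
theorem toyModel_pohlmannTheorem31_of_algDuality (h28 : toyModel.Fact_algDuality) :
    toyModel.PohlmannBasis ∧ toyModel.PohlmannTheorem31 :=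
  ⟨toyModel_pohlmannBasis (toyModel_axioms h28), toyModel_pohlmannTheorem31 (toyModel_axioms h28)⟩

end HodgeCM.Toy

end
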